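import Summits.AtomisticToContinuum.HydrodynamicLimit.Theses.CollisionIsometryCLT
import Summits.AtomisticToContinuum.HydrodynamicLimit.Theorems.CollisionIsometryCLTKineticEngineGlue

/-!
# Route CollisionIsometryCLT — the pure-logic `Assembly` item (stmt-AtomisticToContinuum-14872)

`Assembly` is, by construction of the route (rev 12–13, crux-only pre-shock restatement; the
rev-11 item stmt-AtomisticToContinuum-14678 had the same shape with the `∀ t > 0` decls), literally
the type of the route's deciding theorem `closes`:

  `DiffuseBackwardInfluence → AdaptedWeightCLT → AprioriBoundsPreShock →
   CollisionalTransferLocality → MacroClosure → HydrodynamicLimit`.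

Proof (pure logic): the kinetic engine glue `kineticEngineGlue_proof`
(`Theorems/CollisionIsometryCLTKineticEngineGlue.lean`, support item stmt-AtomisticToContinuum-14871:
`DiffuseBackwardInfluence → AdaptedWeightCLT → AprioriBoundsPreShock → FastMomentRelaxationPreShock`,
i.e. σ₀ := min σ₁ (min σ₂ σ₃), η₁ := the η₁ of `AprioriBoundsPreShock`, the first hypothesis of
`AdaptedWeightCLT` at `(σ, Φ)` being the conclusion of `DiffuseBackwardInfluence` verbatim and the
per-`t` one component (i) of `AprioriBoundsPreShock` at `0 < t < T` in the dilute chamber)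
produces the target `FastMomentRelaxationPreShock`, and the interface crux `MacroClosure` carries
it, together with `CollisionalTransferLocality` and `AprioriBoundsPreShock`, to the sub-problem
statement `HydrodynamicLimit`.
-/

namespace Summit.AtomisticToContinuum.HydrodynamicLimit.Theorems

open Summit.AtomisticToContinuum.HydrodynamicLimit.Theses in
/-- The `Assembly` item of route CollisionIsometryCLT (stmt-AtomisticToContinuum-14872), pure logic:
the five cruxes `DiffuseBackwardInfluence`, `AdaptedWeightCLT`, `AprioriBoundsPreShock`,
`CollisionalTransferLocality`, `MacroClosure` imply the sub-problem statement `HydrodynamicLimit` —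
the engine glue `kineticEngineGlue_proof` produces `FastMomentRelaxationPreShock` from the first
three, and the interface crux `MacroClosure` carries it with `CollisionalTransferLocality` and
`AprioriBoundsPreShock` to `HydrodynamicLimit`. -/
theorem collisionIsometryCLT_assembly_proof :
    Summit.AtomisticToContinuum.HydrodynamicLimit.Theses.CollisionIsometryCLT.Assembly := by
  unfold CollisionIsometryCLT.Assembly
  intro hD hC h₃ h₂ hM
  exact hM h₂ h₃ (kineticEngineGlue_proof hD hC h₃)

end Summit.AtomisticToContinuum.HydrodynamicLimit.Theorems
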